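import Summits.Ventures.HodgeRepro.Night4ReducedDimTwelveAbelian
import Summits.Ventures.HodgeRepro.Night4ReducedDimTwelveNonabelian
import Summits.Ventures.HodgeRepro.Night4ReducedDimEightRoute

/-!
# Degree 12 on the kernel, IV: `9 ≤ dim B_red` on every census face of every Galois CM field of degree 12

Blind re-derivation cell `pub-hodge-repro`, seat `night-4` (ROUTE HARDENING for the Monday FINAL, gen 5).  Target tree
path `lean/Summits/Ventures/HodgeRepro/Night4ReducedDimTwelveRoute.lean`.

ROUTE.md v2.89 §3.4 «Degree 12 — 88 census classes, all OPEN, dim B_red ≥ 9» and §3.5 (i) «the ninefolds S₃ × A₆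
(C6 × C2, D6) and S₃ × S₃′ × S₃″ (D6)» as the smallest open objects of degree 12; §0: «of degree 12: C12, C6×C2, D6, Dic3
(p6's Classify12)».  Parts I–III put the value set of `dim B_red` on the kernel for each of the six named pairs `(G, c)`
of order 12.  This file assembles them in the shape of gen 4's degree-8 file (`Night4ReducedDimEightRoute`):

* `Order12Classified c` — `(G, c)` is isomorphic to one of the six named pairs; `Order12Classified.of_mulEquiv` — the
  named involutions are ALL the central involutions of the four groups; `Night4Classify12` — the classification «every
  group of order 12 with a central involution is `C12`, `C6 × C2`, `D6` or `Dic3`» as a NAMED hypothesis about groups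
  (p6's `Classify12` is not this seat's; the fifth group of order 12, `A₄`, has trivial centre — `complexConjs_A4 = ∅`
  below — so it is the Galois group of no CM field); `nine_le_redDim_faceCorners_of_card_twelve` — the bound for EVERY
  `(G, c)` of order 12 modulo that hypothesis;
* **`redDim_faceCorners_of_order12`**: every census face of every classified `(G, c)` of order 12 has
  `dim B_red ∈ {9, 10, 12, 13, 14, 15, 18, 20, 21, 24}`, hence **`nine_le_redDim_faceCorners_of_order12 : 9 ≤ dim B_red`**
  (ROUTE.md §3.4's bound, KERNEL on every named pair, transported along the isomorphism);
* `eight_lt_redDim_faceCorners_of_order12`: every degree-12 census face is strictly larger than every degree-8 one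
  (`dim B_red ≤ 8` there, `Night4ReducedDimEightRoute`), so the sixfolds / sevenfold / eightfolds of degree 8 stay the
  smallest open objects of the census (§3.5 (i));
* `ninefolds_deg12`: the value 9 is attained on `C6 × C2` (`S₃ × A₆`) and on `D6` (`S₃ × S₃′ × S₃″`), and on `C12` every
  face has `12 ≤ dim B_red`, on `Dic3` `14 ≤ dim B_red` — exactly §3.5 (i)'s list of ninefolds.

What this does NOT do: the non-census `SumTwo` quadruples of degree 12 (patterns `(3,2,1)` and `(2,2,2)`, ROUTE.md §3.1 /
§3.4) are not faces `(Φ; π, π′)` and are not covered — in degree 8 every conjugate-free `SumTwo` quadruple is a face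
(typer's `isFace_of_sumTwo_of_card_le_eight`), in degree 12 it is not, so there is no `TypeDatum.redDim_of_order12` here.
Nothing here says anything about the status of the Hodge conjecture for CM abelian varieties, which is NOT proved.
-/

set_option autoImplicit false

open Finset

namespace HodgeRepro

/-! ## The classification of order 12 as a predicate and as a named hypothesis -/

section Order12

variable {G : Type} [Group G] [Fintype G] [DecidableEq G]

/-- **`(G, c)` is one of the six named pairs of order 12** (ROUTE.md §0: «of degree 12: C12, C6×C2, D6, Dic3»; the three
involutions of `C6 × C2` by typer's `complexConjs_C6xC2`). -/
def Order12Classified (c : G) : Prop :=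
  (∃ e : G ≃* C12, e c = cc_C12) ∨
  (∃ e : G ≃* C6xC2, e c = cc_C6xC2 ∨ e c = cc_C6xC2' ∨ e c = cc_C6xC2'') ∨
  (∃ e : G ≃* D6, e c = cc_D6) ∨ (∃ e : G ≃* Dic3, e c = cc_Dic3)

omit [DecidableEq G] in
/-- A classified pair has order 12. -/
theorem Order12Classified.card_eq_twelve {c : G} (h : Order12Classified c) : Fintype.card G = 12 := by
  rcases h with ⟨e, -⟩ | ⟨e, -⟩ | ⟨e, -⟩ | ⟨e, -⟩
  · rw [← card_eq_of_mulEquiv e, card_C12]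
  · rw [← card_eq_of_mulEquiv e, card_C6xC2]
  · rw [← card_eq_of_mulEquiv e, card_D6]
  · rw [← card_eq_of_mulEquiv e, card_Dic3]

omit [Fintype G] [DecidableEq G] in
/-- **The named involutions are all the central involutions**: if `G` is isomorphic to `C12`, `C6 × C2`, `D6` or
`Dic3`, then `(G, c)` is classified for EVERY complex conjugation `c` of `G` (typer's `complexConjs_C12` /
`complexConjs_C6xC2` / `complexConjs_D6` / `complexConjs_Dic3`, transported along the isomorphism). -/
theorem Order12Classified.of_mulEquiv {c : G} (hc : IsComplexConj c)
    (h : Nonempty (G ≃* C12) ∨ Nonempty (G ≃* C6xC2) ∨ Nonempty (G ≃* D6) ∨ Nonempty (G ≃* Dic3)) :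
    Order12Classified c := by
  rcases h with h | h | h | h
  · obtain ⟨e⟩ := h
    have hm := mem_complexConjs.2 (hc.map e)
    rw [complexConjs_C12, Finset.mem_singleton] at hm
    exact Or.inl ⟨e, hm⟩
  · obtain ⟨e⟩ := h
    have hm := mem_complexConjs.2 (hc.map e)
    rw [complexConjs_C6xC2] at hm
    simp only [Finset.mem_insert, Finset.mem_singleton] at hm
    exact Or.inr (Or.inl ⟨e, hm⟩)
  · obtain ⟨e⟩ := h
    have hm := mem_complexConjs.2 (hc.map e)
    rw [complexConjs_D6, Finset.mem_singleton] at hm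
    exact Or.inr (Or.inr (Or.inl ⟨e, hm⟩))
  · obtain ⟨e⟩ := h
    have hm := mem_complexConjs.2 (hc.map e)
    rw [complexConjs_Dic3, Finset.mem_singleton] at hm
    exact Or.inr (Or.inr (Or.inr ⟨e, hm⟩))

end Order12

/-- **The classification of the groups of order 12 with a central involution** (p6's `Classify12`, ROUTE.md §0), as a
`Prop` about GROUPS: every group of order 12 with a central involution is isomorphic to `C12`, `C6 × C2`, `D6` or
`Dic3`.  A HYPOTHESIS here (elementary group theory: the five groups of order 12 are these four and `A₄`, and `A₄` has
trivial centre — `complexConjs_A4`); nothing asserted.  Through `Order12Classified.of_mulEquiv` it classifies every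
`(G, c)`: `Order12Classified_of_classify12`. -/
def Night4Classify12 : Prop :=
  ∀ (G : Type) [Group G] [Fintype G] [DecidableEq G], Fintype.card G = 12 → (∃ c : G, IsComplexConj c) →
    Nonempty (G ≃* C12) ∨ Nonempty (G ≃* C6xC2) ∨ Nonempty (G ≃* D6) ∨ Nonempty (G ≃* Dic3)

/-- Under the classification, every `(G, c)` of order 12 is one of the six named pairs. -/
theorem Order12Classified_of_classify12 (hcl : Night4Classify12) {G : Type} [Group G] [Fintype G] [DecidableEq G]
    (hcard : Fintype.card G = 12) {c : G} (hc : IsComplexConj c) : Order12Classified c :=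
  Order12Classified.of_mulEquiv hc (hcl G hcard ⟨c, hc⟩)

/-- `A₄` has no central involution (its centre is trivial): no CM field has Galois group `A₄` — the fifth group of
order 12 is absent from ROUTE.md §0's list for this reason.  KERNEL. -/
theorem complexConjs_A4 : complexConjs (alternatingGroup (Fin 4)) = ∅ := by
  decide +kernel

/-! ## Degree 12 in general, modulo the classification -/

section General

variable {G : Type} [Group G] [Fintype G] [DecidableEq G]

/-- The value set of degree 12: the union of the six tables of parts I–III. -/
def night4Values12 : List ℕ := [9, 10, 12, 13, 14, 15, 18, 20, 21, 24]

/-- **Every census face of every classified `(G, c)` of order 12 has `dim B_red ∈ {9, 10, 12, 13, 14, 15, 18, 20, 21,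
24}`**: transport to the named pair (`redDim_faceCorners_transport`) and parts I–III. -/
theorem redDim_faceCorners_of_order12 {c : G} (hcl : Order12Classified c) {Φ : Finset G} (hΦ : IsCMType c Φ)
    {p p' : G} (hp : p' ∉ place c p) : redDim (faceCorners c Φ p p') ∈ night4Values12 := by
  rcases hcl with ⟨e, hec⟩ | ⟨e, hec | hec | hec⟩ | ⟨e, hec⟩ | ⟨e, hec⟩ <;>
    refine redDim_faceCorners_transport e (· ∈ night4Values12) (fun Φ' p₁ p₂ hΦ' hp' => ?_) hΦ hp <;>
    rw [hec] at hΦ' hp' ⊢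
  · have h := redDim_faceCorners_C12 Φ' p₁ p₂ hΦ' hp'
    simp only [night4Values12, List.mem_cons, List.not_mem_nil, or_false] at h ⊢
    omega
  · have h := redDim_faceCorners_C6xC2 Φ' p₁ p₂ hΦ' hp'
    simp only [night4Values12, List.mem_cons, List.not_mem_nil, or_false] at h ⊢
    omega
  · have h := redDim_faceCorners_C6xC2_01 Φ' p₁ p₂ hΦ' hp'
    simp only [night4Values12, List.mem_cons, List.not_mem_nil, or_false] at h ⊢
    omega
  · have h := redDim_faceCorners_C6xC2_31 Φ' p₁ p₂ hΦ' hp'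
    simp only [night4Values12, List.mem_cons, List.not_mem_nil, or_false] at h ⊢
    omega
  · have h := redDim_faceCorners_D6 Φ' p₁ p₂ hΦ' hp'
    simp only [night4Values12, List.mem_cons, List.not_mem_nil, or_false] at h ⊢
    omega
  · have h := redDim_faceCorners_Dic3 Φ' p₁ p₂ hΦ' hp'
    simp only [night4Values12, List.mem_cons, List.not_mem_nil, or_false] at h ⊢
    omega

/-- **ROUTE.md §3.4 «dim B_red ≥ 9»**: on every census face of every classified `(G, c)` of order 12. -/
theorem nine_le_redDim_faceCorners_of_order12 {c : G} (hcl : Order12Classified c) {Φ : Finset G}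
    (hΦ : IsCMType c Φ) {p p' : G} (hp : p' ∉ place c p) : 9 ≤ redDim (faceCorners c Φ p p') := by
  have h := redDim_faceCorners_of_order12 hcl hΦ hp
  simp only [night4Values12, List.mem_cons, List.not_mem_nil, or_false] at h
  omega

/-- **Every degree-12 census face is strictly larger than every degree-8 one** (`dim B_red ≤ 8` in degree 8,
`Night4ReducedDimEightRoute.redDim_faceCorners_of_order8_bounds`): the sixfolds, the sevenfold and the eightfolds of
degree 8 stay the smallest open objects of the census (ROUTE.md §3.5 (i)). -/
theorem eight_lt_redDim_faceCorners_of_order12 {c : G} (hcl : Order12Classified c) {Φ : Finset G}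
    (hΦ : IsCMType c Φ) {p p' : G} (hp : p' ∉ place c p) : 8 < redDim (faceCorners c Φ p p') := by
  have h := nine_le_redDim_faceCorners_of_order12 hcl hΦ hp
  omega

/-- **ROUTE.md §3.4 «dim B_red ≥ 9» for EVERY Galois CM field of degree 12, modulo the classification
`Night4Classify12`**: on every census face of every `(G, c)` with `|G| = 12`. -/
theorem nine_le_redDim_faceCorners_of_card_twelve (hcl : Night4Classify12) (hcard : Fintype.card G = 12) {c : G}
    (hc : IsComplexConj c) {Φ : Finset G} (hΦ : IsCMType c Φ) {p p' : G} (hp : p' ∉ place c p) :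
    9 ≤ redDim (faceCorners c Φ p p') :=
  nine_le_redDim_faceCorners_of_order12 (Order12Classified_of_classify12 hcl hcard hc) hΦ hp

/-- `dim B_red ≤ 24` on every census face of every classified `(G, c)` of order 12 (four simple sixfolds at most). -/
theorem redDim_faceCorners_of_order12_le {c : G} (hcl : Order12Classified c) {Φ : Finset G}
    (hΦ : IsCMType c Φ) {p p' : G} (hp : p' ∉ place c p) : redDim (faceCorners c Φ p p') ≤ 24 := by
  have h := redDim_faceCorners_of_order12 hcl hΦ hp
  simp only [night4Values12, List.mem_cons, List.not_mem_nil, or_false] at h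
  omega

end General

/-! ## The ninefolds of §3.5 (i) -/

/-- **ROUTE.md §3.5 (i)'s ninefolds, exactly**: `dim B_red = 9` is attained on `C6 × C2` (the ninefold `S₃ × A₆`) and on
`D6` (`S₃ × S₃′ × S₃″`), while on `C12` every census face has `12 ≤ dim B_red` and on `Dic3` `14 ≤ dim B_red`. -/
theorem ninefolds_deg12 :
    (∃ (Φ : Finset C6xC2) (p p' : C6xC2), IsCMType cc_C6xC2 Φ ∧ p' ∉ place cc_C6xC2 p ∧
      redDim (faceCorners cc_C6xC2 Φ p p') = 9) ∧
    (∃ (Φ : Finset D6) (p p' : D6), IsCMType cc_D6 Φ ∧ p' ∉ place cc_D6 p ∧ redDim (faceCorners cc_D6 Φ p p') = 9) ∧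
    (∀ (Φ : Finset C12) (p p' : C12), IsCMType cc_C12 Φ → p' ∉ place cc_C12 p →
      12 ≤ redDim (faceCorners cc_C12 Φ p p')) ∧
    (∀ (Φ : Finset Dic3) (p p' : Dic3), IsCMType cc_Dic3 Φ → p' ∉ place cc_Dic3 p →
      14 ≤ redDim (faceCorners cc_Dic3 Φ p p')) :=
  ⟨redDim_faceCorners_C6xC2_nine, redDim_faceCorners_D6_nine, twelve_le_redDim_faceCorners_C12,
    fourteen_le_redDim_faceCorners_Dic3⟩

end HodgeRepro
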